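import Literature.Probability.Distributions.BrascampLieb
import Literature.Probability.Distributions.BrascampLiebLinAlg
import HarnessLib

/-!
# Calculus glue for the Brascamp–Lieb induction: fibres along `Fin.cons`

`Literature/Probability/Distributions/`. For the cube-induction proof of the Brascamp–Lieb
variance inequality (`BrascampLieb1976_thm41`, file `BrascampLieb`) one splits
`x ∈ ℝ^{m+1}` as `x = (y, z) = Fin.cons y z` with `y ∈ ℝ`, `z ∈ ℝ^m`. This file relates the
coordinate gradient / Hessian (`coordGradient`, `coordHessian` of file `BrascampLieb`) of the fibre
functions `z ↦ f(y, z)` and `y ↦ f(y, z)` to those of `f`: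

* chain rules `∂ᵢ(F(y,·)) = ∂_{i+1}F`, `d/dy F(y,z) = ∂₀F` (`fderiv_comp_cons_right`,
  `hasDerivAt_comp_cons_left`), fibre gradient and fibre Hessian = lower-right block
  (`coordGradient_comp_cons`, `coordHessian_comp_cons`), positivity of the fibre Hessian;
* continuity of `∇h`, `f_xx`, `(f_xx)⁻¹` and of the Brascamp–Lieb integrand
  `∇hᵀ (f_xx)⁻¹ ∇h` for `f ∈ C²` with positive definite Hessian, `h ∈ C¹`;
* the pointwise inequality of the inductive step (`blQuad_fibre_bound`): for every real `t`,
  `∇hᵀ f_xx⁻¹ ∇h ≥ 2t ∂₀h − t² f₀₀ + ∇_zφ_tᵀ f_zz⁻¹ ∇_zφ_t`, `φ_t = h(y,·) − t ∂₀f(y,·)`,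
  obtained from the variational bound of `BrascampLiebLinAlg` — this is the matrix content of
  Brascamp–Lieb's eqs. (4.9)–(4.10) without Schur complements.

No definitions.
-/

noncomputable section

open Matrix MeasureTheory Set Filter
open scoped Topology

namespace Literature.Probability.Distributions


variable {m : ℕ}

/-! ### `Fin.cons` maps -/

/-- `z ↦ (y, z)` is smooth. [folklore] -/
theorem contDiff_cons_right {n : WithTop ℕ∞} (y : ℝ) :
    ContDiff ℝ n (fun z : Fin m → ℝ => (Fin.cons y z : Fin (m + 1) → ℝ)) := by
  have : (fun z : Fin m → ℝ => (Fin.cons y z : Fin (m + 1) → ℝ)) =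
      (Fin.consEquivL ℝ (fun _ : Fin (m + 1) => ℝ)) ∘ (fun z => (y, z)) := by
    funext z; rfl
  rw [this]
  exact (Fin.consEquivL ℝ (fun _ : Fin (m + 1) => ℝ)).contDiff.comp (contDiff_prodMk_right y)

/-- `y ↦ (y, z)` is smooth. [folklore] -/
theorem contDiff_cons_left {n : WithTop ℕ∞} (z : Fin m → ℝ) :
    ContDiff ℝ n (fun y : ℝ => (Fin.cons y z : Fin (m + 1) → ℝ)) := by
  have : (fun y : ℝ => (Fin.cons y z : Fin (m + 1) → ℝ)) =
      (Fin.consEquivL ℝ (fun _ : Fin (m + 1) => ℝ)) ∘ (fun y => (y, z)) := by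
    funext y; rfl
  rw [this]
  exact (Fin.consEquivL ℝ (fun _ : Fin (m + 1) => ℝ)).contDiff.comp (contDiff_prodMk_left z)

/-- `(y, z) ↦ (y, z) ∈ ℝ^{m+1}` is continuous. [folklore] -/
theorem continuous_cons_uncurry :
    Continuous (fun p : ℝ × (Fin m → ℝ) => (Fin.cons p.1 p.2 : Fin (m + 1) → ℝ)) :=
  Continuous.finCons (A := fun _ : Fin (m + 1) => ℝ) continuous_fst continuous_snd

/-- `z ↦ (y, z)` has derivative `w ↦ (0, w)`. [folklore] -/
theorem hasFDerivAt_cons_right (y : ℝ) (z : Fin m → ℝ) :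
    HasFDerivAt (fun z : Fin m → ℝ => (Fin.cons y z : Fin (m + 1) → ℝ))
      ((0 : (Fin m → ℝ) →L[ℝ] ℝ).finCons (ContinuousLinearMap.id ℝ (Fin m → ℝ))) z :=
  (hasFDerivAt_const y z).finCons (hasFDerivAt_id z)

/-- `y ↦ (y, z)` has derivative `s ↦ (s, 0)`. [folklore] -/
theorem hasFDerivAt_cons_left (y : ℝ) (z : Fin m → ℝ) :
    HasFDerivAt (fun y : ℝ => (Fin.cons y z : Fin (m + 1) → ℝ))
      ((ContinuousLinearMap.id ℝ ℝ).finCons (0 : ℝ →L[ℝ] (Fin m → ℝ))) y :=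
  (hasFDerivAt_id y).finCons (hasFDerivAt_const z y)

/-- Chain rule along the fibre: `∂ᵢ (F(y, ·))(z) = ∂_{i+1} F (y, z)`. [folklore] -/
theorem fderiv_comp_cons_right {F : (Fin (m + 1) → ℝ) → ℝ} {y : ℝ} {z : Fin m → ℝ}
    (hF : DifferentiableAt ℝ F (Fin.cons y z)) (i : Fin m) :
    fderiv ℝ (fun z : Fin m → ℝ => F (Fin.cons y z)) z (Pi.single i 1) =
      fderiv ℝ F (Fin.cons y z) (Pi.single i.succ 1) := by
  have h : HasFDerivAt (fun z : Fin m → ℝ => F (Fin.cons y z)) _ z :=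
    hF.hasFDerivAt.comp z (hasFDerivAt_cons_right y z)
  -- `(0, eᵢ) = e_{i+1}` (cf. `SpaceCurve.cons_zero_single` in the Wilkie files)
  have hcons : (Fin.cons 0 (Pi.single i 1) : Fin (m + 1) → ℝ) = Pi.single i.succ 1 := by
    ext j
    refine Fin.cases ?_ (fun k => ?_) j
    · simp
    · simp [Pi.single_apply]
  rw [h.fderiv, ContinuousLinearMap.comp_apply, ← hcons]
  congr 1

/-- Chain rule across the fibres: `d/dy F(y, z) = ∂₀ F (y, z)`. [folklore] -/
theorem hasDerivAt_comp_cons_left {F : (Fin (m + 1) → ℝ) → ℝ} {y : ℝ} {z : Fin m → ℝ}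
    (hF : DifferentiableAt ℝ F (Fin.cons y z)) :
    HasDerivAt (fun y : ℝ => F (Fin.cons y z)) (fderiv ℝ F (Fin.cons y z) (Pi.single 0 1)) y := by
  have h : HasDerivAt (fun y : ℝ => F (Fin.cons y z)) _ y :=
    (hF.hasFDerivAt.comp y (hasFDerivAt_cons_left y z)).hasDerivAt
  -- `(1, 0) = e₀` (cf. `SpaceCurve.cons_one_zero` in the Wilkie files)
  have hcons : (Fin.cons 1 0 : Fin (m + 1) → ℝ) = Pi.single 0 1 := by
    ext j
    refine Fin.cases ?_ (fun k => ?_) j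
    · simp
    · simp [Fin.succ_ne_zero]
  refine h.congr_deriv ?_
  rw [ContinuousLinearMap.comp_apply, ← hcons]
  congr 1

/-! ### Regularity of partial derivatives -/

/-- For `f ∈ C²`, each first partial `x ↦ ∂ᵥ f(x)` is `C¹`. [folklore] -/
theorem contDiff_one_fderiv_apply {E : Type*} [NormedAddCommGroup E] [NormedSpace ℝ E]
    {f : E → ℝ} (hf : ContDiff ℝ 2 f) (v : E) :
    ContDiff ℝ 1 (fun x => fderiv ℝ f x v) :=
  (hf.fderiv_right (m := 1) (by norm_num)).clm_apply contDiff_const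

/-- For `h ∈ C¹`, each first partial `x ↦ ∂ᵥ h(x)` is continuous. [folklore] -/
theorem continuous_fderiv_apply {E : Type*} [NormedAddCommGroup E] [NormedSpace ℝ E]
    {h : E → ℝ} (hh : ContDiff ℝ 1 h) (v : E) :
    Continuous (fun x => fderiv ℝ h x v) :=
  (hh.continuous_fderiv (by norm_num)).clm_apply continuous_const

/-- For `h ∈ C¹`, the coordinate gradient is continuous. [folklore] -/
theorem continuous_coordGradient {n : ℕ} {h : (Fin n → ℝ) → ℝ} (hh : ContDiff ℝ 1 h) :
    Continuous (fun x => coordGradient h x) :=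
  continuous_pi fun i => continuous_fderiv_apply hh (Pi.single i 1)

/-- For `f ∈ C²`, the coordinate Hessian is continuous. [folklore] -/
theorem continuous_coordHessian {n : ℕ} {f : (Fin n → ℝ) → ℝ} (hf : ContDiff ℝ 2 f) :
    Continuous (fun x => coordHessian f x) := by
  refine continuous_pi fun i => continuous_pi fun j => ?_
  simp only [coordHessian, of_apply]
  exact continuous_fderiv_apply (contDiff_one_fderiv_apply hf _) _

/-- For `f ∈ C²` with positive definite Hessian, `x ↦ (f''(x))⁻¹` is continuous. [folklore] -/
theorem continuous_coordHessian_inv {n : ℕ} {f : (Fin n → ℝ) → ℝ} (hf : ContDiff ℝ 2 f)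
    (hpd : ∀ x, (coordHessian f x).PosDef) : Continuous (fun x => (coordHessian f x)⁻¹) :=
  continuous_matrix_inv_of_det_ne_zero (continuous_coordHessian hf) fun x => (hpd x).det_pos.ne'

/-- The Brascamp–Lieb integrand `∇hᵀ (f'')⁻¹ ∇h` is continuous for `f ∈ C²` with positive
definite Hessian and `h ∈ C¹`. [folklore] -/
theorem continuous_blQuad {n : ℕ} {f h : (Fin n → ℝ) → ℝ} (hf : ContDiff ℝ 2 f)
    (hpd : ∀ x, (coordHessian f x).PosDef) (hh : ContDiff ℝ 1 h) :
    Continuous (fun x => coordGradient h x ⬝ᵥ ((coordHessian f x)⁻¹ *ᵥ coordGradient h x)) :=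
  (continuous_coordGradient hh).dotProduct
    ((continuous_coordHessian_inv hf hpd).matrix_mulVec (continuous_coordGradient hh))

/-- The Brascamp–Lieb integrand is nonnegative. [folklore] -/
theorem blQuad_nonneg {n : ℕ} {f h : (Fin n → ℝ) → ℝ} (hpd : ∀ x, (coordHessian f x).PosDef)
    (x : Fin n → ℝ) : 0 ≤ coordGradient h x ⬝ᵥ ((coordHessian f x)⁻¹ *ᵥ coordGradient h x) :=
  inv_quadForm_nonneg (hpd x) _

/-! ### Fibre functions `z ↦ f(y, z)` and their coordinate derivatives -/

/-- The coordinate gradient of a fibre function: `∇_z (h(y,·))(z) = (∂_{i+1} h(y,z))ᵢ`.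
[folklore] -/
theorem coordGradient_comp_cons {h : (Fin (m + 1) → ℝ) → ℝ} {y : ℝ} {z : Fin m → ℝ}
    (hh : DifferentiableAt ℝ h (Fin.cons y z)) :
    coordGradient (fun z : Fin m → ℝ => h (Fin.cons y z)) z =
      fun i => coordGradient h (Fin.cons y z) i.succ := by
  funext i
  simp only [coordGradient]
  exact fderiv_comp_cons_right hh i

/-- The coordinate Hessian of a fibre function is the lower-right block of the Hessian:
`(f(y,·))_zz = (f_xx)_{succ, succ}`. [folklore] -/
theorem coordHessian_comp_cons {f : (Fin (m + 1) → ℝ) → ℝ} (hf : ContDiff ℝ 2 f) (y : ℝ)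
    (z : Fin m → ℝ) :
    coordHessian (fun z : Fin m → ℝ => f (Fin.cons y z)) z =
      (coordHessian f (Fin.cons y z)).submatrix Fin.succ Fin.succ := by
  ext i j
  simp only [coordHessian, of_apply, submatrix_apply]
  have hdiff : ∀ x, DifferentiableAt ℝ f x := fun x => (hf.differentiable (by norm_num)) x
  have e1 : (fun z' : Fin m → ℝ => fderiv ℝ (fun z : Fin m → ℝ => f (Fin.cons y z)) z'
      (Pi.single j 1)) = fun z' => (fun x => fderiv ℝ f x (Pi.single j.succ 1)) (Fin.cons y z') := by
    funext z'
    exact fderiv_comp_cons_right (hdiff _) j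
  rw [e1]
  exact fderiv_comp_cons_right
    (((contDiff_one_fderiv_apply hf _).differentiable one_ne_zero) _) i

/-- The coordinate gradient of `h − t g` is `∇h − t ∇g`. [folklore] -/
theorem coordGradient_sub_const_mul {n : ℕ} {h g : (Fin n → ℝ) → ℝ} {x : Fin n → ℝ}
    (hh : DifferentiableAt ℝ h x) (hg : DifferentiableAt ℝ g x) (t : ℝ) :
    coordGradient (fun x => h x - t * g x) x =
      fun i => coordGradient h x i - t * coordGradient g x i := by
  funext i
  simp only [coordGradient]
  rw [fderiv_fun_sub hh (hg.const_mul t), fderiv_const_mul hg]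
  simp

/-- The fibre function `z ↦ f(y, z)` of a `Cⁿ` function is `Cⁿ`. [folklore] -/
theorem contDiff_comp_cons_right {n : WithTop ℕ∞} {F : (Fin (m + 1) → ℝ) → ℝ}
    (hF : ContDiff ℝ n F) (y : ℝ) : ContDiff ℝ n (fun z : Fin m → ℝ => F (Fin.cons y z)) :=
  hF.comp (contDiff_cons_right y)

/-- The fibre Hessian of a `C²` function with positive definite Hessian is positive definite.
[folklore] -/
theorem posDef_coordHessian_comp_cons {f : (Fin (m + 1) → ℝ) → ℝ} (hf : ContDiff ℝ 2 f)
    (hpd : ∀ x, (coordHessian f x).PosDef) (y : ℝ) (z : Fin m → ℝ) :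
    (coordHessian (fun z : Fin m → ℝ => f (Fin.cons y z)) z).PosDef := by
  rw [coordHessian_comp_cons hf]
  exact (hpd _).submatrix (Fin.succ_injective m)

/-! ### The pointwise variational bound along a fibre -/

/-- **Pointwise step of the Brascamp–Lieb induction.** At `x = (y, z)`, for every real `t`,
`∇hᵀ f_xx⁻¹ ∇h ≥ 2 t ∂₀h − t² f₀₀ + (∇_z φ_t)ᵀ (f_zz)⁻¹ (∇_z φ_t)` where
`φ_t = h(y, ·) − t ∂₀f(y, ·)` (take `w = (t, f_zz⁻¹ ∇_zφ_t)` in `2∇h·w − wᵀf_xx w ≤ ∇hᵀf_xx⁻¹∇h`).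
[cite: BrascampLieb1976, proof of Thm 4.1, eqs. (4.9)–(4.10)] -/
theorem blQuad_fibre_bound {f h : (Fin (m + 1) → ℝ) → ℝ} (hf : ContDiff ℝ 2 f)
    (hpd : ∀ x, (coordHessian f x).PosDef) (hh : ContDiff ℝ 1 h) (y : ℝ) (z : Fin m → ℝ)
    (t : ℝ) :
    2 * t * coordGradient h (Fin.cons y z) 0 - t ^ 2 * coordHessian f (Fin.cons y z) 0 0 +
      coordGradient (fun z : Fin m → ℝ => h (Fin.cons y z) -
          t * fderiv ℝ f (Fin.cons y z) (Pi.single 0 1)) z ⬝ᵥ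
        ((coordHessian (fun z : Fin m → ℝ => f (Fin.cons y z)) z)⁻¹ *ᵥ
          coordGradient (fun z : Fin m → ℝ => h (Fin.cons y z) -
            t * fderiv ℝ f (Fin.cons y z) (Pi.single 0 1)) z) ≤
    coordGradient h (Fin.cons y z) ⬝ᵥ
      ((coordHessian f (Fin.cons y z))⁻¹ *ᵥ coordGradient h (Fin.cons y z)) := by
  have hMpd : (coordHessian f (Fin.cons y z)).PosDef := hpd _
  have hsymm : ∀ i : Fin m, coordHessian f (Fin.cons y z) i.succ 0 =
      coordHessian f (Fin.cons y z) 0 i.succ := fun i => by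
    have e := hMpd.isHermitian.apply i.succ 0
    rw [star_trivial] at e
    exact e.symm
  have hf0 : ContDiff ℝ 1 (fun x => fderiv ℝ f x (Pi.single 0 1)) :=
    contDiff_one_fderiv_apply hf _
  have hhd : DifferentiableAt ℝ (fun z : Fin m → ℝ => h (Fin.cons y z)) z :=
    ((hh.comp (contDiff_cons_right y)).differentiable one_ne_zero) z
  have hgd : DifferentiableAt ℝ
      (fun z : Fin m → ℝ => fderiv ℝ f (Fin.cons y z) (Pi.single 0 1)) z :=
    ((hf0.comp (contDiff_cons_right y)).differentiable one_ne_zero) z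
  have hgrad : coordGradient (fun z : Fin m → ℝ => h (Fin.cons y z) -
      t * fderiv ℝ f (Fin.cons y z) (Pi.single 0 1)) z =
      fun i => coordGradient h (Fin.cons y z) i.succ -
        t * coordHessian f (Fin.cons y z) 0 i.succ := by
    rw [coordGradient_sub_const_mul hhd hgd t,
      coordGradient_comp_cons ((hh.differentiable one_ne_zero) _),
      coordGradient_comp_cons (h := fun x => fderiv ℝ f x (Pi.single 0 1))
        ((hf0.differentiable one_ne_zero) _)]
    funext i
    rw [← hsymm i]
    rfl
  rw [hgrad, coordHessian_comp_cons hf]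
  exact fibre_test_bound hMpd _ t

end Literature.Probability.Distributions
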